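import Summits.BirchSwinnertonDyer.BirchSwinnertonDyer.Theorems.ErratumRoadFiveSelfDualCharactersTorsion
import Literature.NumberTheory.EllipticCurves.AnticyclotomicLocalNormResidueSymbolProofs
import Literature.NumberTheory.EllipticCurves.HeckePolynomialRootNormProofs
import Literature.NumberTheory.EllipticCurves.StrictSelmerRankOneDegreeOneProofs
import HarnessLib

/-!
# The anticyclotomic local symbol `σ_K ∈ Γ_{K_𝔭̄}` (Serre's `θ_𝔭̄(π̄/π)`) SEPARATES EXPONENTS for both diagonal characters
# `χ† = ψT₀₀`, `δ† = ψT₁₁` of the self-dual frame — the number-theoretic heart of (FIX)† (helper, `--supports stmt-BirchSwinnertonDyer-23253`)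

Cell `bsd-stepL`, seat `bsd-stepL-imc-p1` (prover g25, 2026-08-28). Theorems only (no definition, no named fact, no `sorry`, no
instance, no notation). Third data-level step of the kernel discharge of (FIX)† (stub `stub_finiteFixedPartAnomalous_selfDual` of line
`erratum_chain`† of crux 23253; seat NOTES §FIX†): the hypotheses `hK₂`, `hK₁`, `hsep` of `FixTwist.apply_ne_one_of_pow_eq_one_of_ker`.

THE ARGUMENT. Let `𝔭̄^h = (π)` (`ZpExtension.exists_pow_asIdeal_eq_span`). The tree theorem
`ZpExtension.exists_isFrobPow_mem_kerSubgroup_cyclotomicCharacter_mul_sq_eq` (Serre's local symbol of `c(π)/π`, product formula +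
anticyclotomy; exact form appended by this seat) gives `σ_K ∈ Γ_{K_𝔭̄}` of Frobenius degree `h`, in `ker κ` for every anticyclotomic `κ`, and
a ring map `φ : K → ℚ_p` with `ε(σ_K)·φ(π)² = p^{2h}`. In the frame (`T₁₁` unramified with Frobenius value `α`, a root of
`X² − ι_g(a_p)X + p^{k−1}`; `T₀₀T₁₁ = ε^{k−1}`; `ψ = ε^{1−k/2}`, `k = 2m₂`): `χ†(σ_K)·α^h = E^{m₂}` and `δ†(σ_K)·E^{m₂} = E·α^h` with
`E = ε(σ_K) ∈ ℚ̄_p`. Through a field isomorphism `ι' : ℚ̄_p ≃ ℂ` compatible with `ι_g`, `|ι'E| = p^h` (`|τπ|² = p^h` for the embedding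
`τ = ι' ∘ φ` of the imaginary quadratic `K`), so a torsion value `χ†(σ_K)^n = 1` (resp. `δ†(σ_K)^n = 1`) would force `|ι'α| = p^{m₂}`
(resp. `p^{m₂−1}`) — excluded by `norm_ringEquiv_ne_of_root_heckePolynomial_padic` (the STRICT trivial Hecke bound; no Deligne). Units of
`𝒪` of infinite order separate exponents (`PadicUnitPowers.tendsto_natCast_padicInt_zero_of_tendsto_pow_of_norm_pow_sub_one_lt`). Finally
`κ'(σ_K) ≠ 0`: otherwise `σ_K ∈ P ⊆ ker ν` for the unramified combination `ν`, but `ν(σ_K) = h·ν(Frob) ≠ 0` ((OPEN)).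

* `exists_symbol` — the statement, for an arbitrary frame `Q'` with the three frame properties.

HONEST FRAMING: a lemma about characters; nothing about BSD for any pair; closes: none (T7).

## References
* [CasselsFrohlichANT1967] Ch. VI §3.1 Thm. 2, Ch. VII §6 Prop. 6.2; [Brink2007] §II Prop. 1; [DiamondShurman2005] Thm. 5.5.3;
  [SerreLocalFields1979] Ch. IV §3–4; [Rubin1991] §5; [JetchevSkinnerWan2017] §3.3 Case 3(b).
-/

noncomputable section

-- D-0017: single-problem summit, the namespace repeats the problem name by design.
set_option linter.dupNamespace false
set_option autoImplicit false

open scoped MatrixGroups Matrix ModularForm NumberField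
open Filter Topology Field NumberField IsDedekindDomain CongruenceSubgroup UpperHalfPlane
open Literature.NumberTheory.GaloisRepresentations Literature.NumberTheory.GaloisRepresentations.IsNonarchimedeanLocalField
open Literature.NumberTheory.EllipticCurves Literature.NumberTheory.EllipticCurves.ModularForms
open Literature.NumberTheory.EllipticCurves.GreenbergSelmer Literature.NumberTheory.EllipticCurves.BigGaloisRep
open Literature.NumberTheory.EllipticCurves.ZpExtension
open Literature.FieldTheory.AlgClosed

namespace Summit.BirchSwinnertonDyer.BirchSwinnertonDyer.Theorems.ErratumThm23TwoVariable.CharSymbolSelfDual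

variable {p : ℕ} [Fact p.Prime] {M : ℕ} [NeZero M] {k : ℤ}
  {g : CuspForm (CongruenceSubgroup.Gamma0 M) k} {ιg : coeffField g →+* PadicAlgCl p}

/-- If `(x y)^n = z^n`-type identities force a norm: `a^n = b^n` for `0 ≤ a, b` and `0 < n` gives `a = b` (reals). [folklore] -/
theorem eq_of_pow_eq_pow_of_nonneg {a b : ℝ} (ha : 0 ≤ a) (hb : 0 ≤ b) {n : ℕ} (hn : 0 < n) (h : a ^ n = b ^ n) : a = b :=
  (pow_left_inj₀ ha hb hn.ne').mp h

set_option maxHeartbeats 1600000 in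
-- many local definitions over the frame; the proof is elementary but long
/-- **The anticyclotomic local symbol separates exponents for `χ†` and `δ†`.** For an ordinary newform datum `Δ` (newform, even weight
`k ≥ 2`, `p ∤ M`, `p > 3`, `|ι a_p| = 1`), `K` imaginary quadratic with `p` split, `𝔭̄ ∣ p`, `κ` anticyclotomic, `κ'` cyclotomic, and ANY
frame `Q'` of `Δ.ρ ∘ res ∘ loc` on `Γ_{K_𝔭̄}` (upper triangular, `T₁₁ = 1` on inertia, `T₁₁` a Hecke root at arithmetic Frobenii): there is
`σ_K ∈ Γ_{K_𝔭̄}` with `κ(σ_K) = 0`, `κ'(σ_K) ≠ 0`, and such that for `θ ∈ {(ψT₀₀)(σ_K)⁻¹, (ψT₁₁)(σ_K)⁻¹}` (in `ℚ̄_p`): `θ^{a_m} → 1`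
for naturals `a_m` forces `a_m → 0` in `ℤ_p`.
[cite: CasselsFrohlichANT1967, Ch. VI §3.1 Thm. 2, Ch. VII §6 Prop. 6.2] [cite: DiamondShurman2005, Thm. 5.5.3 and Prop. 5.2.1]
[cite: SerreLocalFields1979, Ch. IV §3 Prop. 9] -/
theorem exists_symbol (Δ : OrdinaryNewformDatum g p ιg) (K : Type) [Field K] [NumberField K]
    (𝔭bar : HeightOneSpectrum (𝓞 K)) (κ κ' : ZpExtension K p)
    (h1 : IsNewform0 g) (h2 : 2 ≤ k) (h3 : Even k) (h4 : ¬ p ∣ M) (h5 : 3 < p)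
    (h7 : IsImaginaryQuadratic K)
    (h8 : ((Ideal.span {(p : ℤ)}).primesOver (𝓞 K)).ncard = 2) (h9 : ((p : ℕ) : 𝓞 K) ∈ 𝔭bar.asIdeal)
    (h10 : κ.IsAnticyclotomic) (h11 : κ'.IsCyclotomic)
    (Q' : GL (Fin 2) (padicCoeffIntegers ιg))
    (hQ' : ∀ τ : absoluteGaloisGroup (𝔭bar.adicCompletion K),
      (Q'⁻¹ * Δ.ρ (absGaloisRestrict ℚ K (absGaloisRestrict K (𝔭bar.adicCompletion K) τ)) * Q').val 1 0 = 0 ∧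
      (τ ∈ absInertia (𝔭bar.adicCompletion K) →
        (Q'⁻¹ * Δ.ρ (absGaloisRestrict ℚ K (absGaloisRestrict K (𝔭bar.adicCompletion K) τ)) * Q').val 1 1 = 1) ∧
      (IsAbsArithFrob τ →
        (padicCoeffIntegers.toPadicAlgCl ιg)
            ((Q'⁻¹ * Δ.ρ (absGaloisRestrict ℚ K (absGaloisRestrict K (𝔭bar.adicCompletion K) τ)) * Q').val 1 1) ^ 2 -
          ιg ⟨(qExpansion 1 ⇑g).coeff p, coeff_mem_coeffField g p⟩ *
            (padicCoeffIntegers.toPadicAlgCl ιg)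
              ((Q'⁻¹ * Δ.ρ (absGaloisRestrict ℚ K (absGaloisRestrict K (𝔭bar.adicCompletion K) τ)) * Q').val 1 1) +
          (p : PadicAlgCl p) ^ (k - 1) = 0)) :
    ∃ σK : absoluteGaloisGroup (𝔭bar.adicCompletion K),
      κ (localMap K (Sum.inl 𝔭bar) σK) = 1 ∧ κ' (localMap K (Sum.inl 𝔭bar) σK) ≠ 1 ∧
      (∀ a : ℕ → ℕ, Tendsto (fun n ↦ ((padicCoeffIntegers.toPadicAlgCl ιg)
            (((selfDualTwistChar ιg (absGaloisRestrict ℚ K (absGaloisRestrict K (𝔭bar.adicCompletion K) σK)) :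
                (padicCoeffIntegers ιg)ˣ) : padicCoeffIntegers ιg) *
              (Q'⁻¹ * Δ.ρ (absGaloisRestrict ℚ K (absGaloisRestrict K (𝔭bar.adicCompletion K) σK)) * Q').val 0 0))⁻¹ ^ a n)
          atTop (𝓝 1) → Tendsto (fun n ↦ ((a n : ℕ) : ℤ_[p])) atTop (𝓝 0)) ∧
      (∀ a : ℕ → ℕ, Tendsto (fun n ↦ ((padicCoeffIntegers.toPadicAlgCl ιg)
            (((selfDualTwistChar ιg (absGaloisRestrict ℚ K (absGaloisRestrict K (𝔭bar.adicCompletion K) σK)) :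
                (padicCoeffIntegers ιg)ˣ) : padicCoeffIntegers ιg) *
              (Q'⁻¹ * Δ.ρ (absGaloisRestrict ℚ K (absGaloisRestrict K (𝔭bar.adicCompletion K) σK)) * Q').val 1 1))⁻¹ ^ a n)
          atTop (𝓝 1) → Tendsto (fun n ↦ ((a n : ℕ) : ℤ_[p])) atTop (𝓝 0)) := by
  classical
  have hp : p.Prime := Fact.out
  have hp2 : p ≠ 2 := by omega
  have hK2 : Module.finrank ℚ K = 2 := h7.1
  haveI : FiniteDimensional ℚ (coeffField g) := IsNewform0.finiteDimensional_coeffField_holds h1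
  haveI : FiniteDimensional ℚ_[p] (padicCoeffField ιg) := GreenbergSelmer.finiteDimensional_padicCoeffField ιg
  haveI : NeZero (p : ℚ) := ⟨Nat.cast_ne_zero.mpr hp.ne_zero⟩
  obtain ⟨m, hm⟩ : ∃ m : ℕ, ((m : ℕ) : ℤ) = k - 1 := ⟨(k - 1).toNat, Int.toNat_of_nonneg (by omega)⟩
  obtain ⟨m₂, hm₂⟩ : ∃ m₂ : ℕ, ((2 * m₂ : ℕ) : ℤ) = k := by
    obtain ⟨r, hr⟩ := h3
    exact ⟨r.toNat, by push_cast; rw [Int.toNat_of_nonneg (by omega)]; omega⟩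
  have hm₂1 : 1 ≤ m₂ := by omega
  have hk2 : k / 2 = m₂ := by omega
  have hmm₂ : (m : ℤ) = 2 * m₂ - 1 := by omega
  set ιO := padicCoeffIntegers.toPadicAlgCl ιg with hιO
  have hιO_inj : Function.Injective ιO := fun x y hxy ↦ Subtype.ext (Subtype.ext hxy)
  have hnat : ∀ n : ℕ, ¬ p ∣ n → ‖(n : PadicAlgCl p)‖ = 1 := fun n hn ↦ PadicAlgCl.norm_natCast_of_not_dvd hn
  -- notation: `res`, the frame `T`
  set res : absoluteGaloisGroup (𝔭bar.adicCompletion K) → absoluteGaloisGroup ℚ :=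
    fun τ ↦ absGaloisRestrict ℚ K (absGaloisRestrict K (𝔭bar.adicCompletion K) τ) with hres
  obtain ⟨T, hTfun⟩ : ∃ T, T = fun τ : absoluteGaloisGroup (𝔭bar.adicCompletion K) ↦ Q'⁻¹ * Δ.ρ (res τ) * Q' := ⟨_, rfl⟩
  have hT : ∀ τ, T τ = Q'⁻¹ * Δ.ρ (res τ) * Q' := fun τ ↦ by rw [hTfun]
  have hT10 : ∀ τ, (T τ).val 1 0 = 0 := fun τ ↦ by rw [hT]; exact (hQ' τ).1
  have hTI : ∀ τ, τ ∈ absInertia (𝔭bar.adicCompletion K) → (T τ).val 1 1 = 1 := fun τ hτ ↦ by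
    rw [hT]; exact (hQ' τ).2.1 hτ
  have hTF : ∀ τ, IsAbsArithFrob τ → ιO ((T τ).val 1 1) ^ 2 -
      ιg ⟨(qExpansion 1 ⇑g).coeff p, coeff_mem_coeffField g p⟩ * ιO ((T τ).val 1 1) + (p : PadicAlgCl p) ^ (k - 1) = 0 :=
    fun τ hτ ↦ by rw [hT]; exact (hQ' τ).2.2 hτ
  have hTmul : ∀ σ τ, T (σ * τ) = T σ * T τ := fun σ τ ↦ by
    simp only [hT, hres, map_mul]; group
  have hTone : T 1 = 1 := by simp only [hT, hres, map_one, mul_one, inv_mul_cancel]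
  -- `δ = T₁₁`: multiplicative and unramified
  let δ : absoluteGaloisGroup (𝔭bar.adicCompletion K) → padicCoeffIntegers ιg := fun τ ↦ (T τ).val 1 1
  have hδmul : ∀ σ τ, δ (σ * τ) = δ σ * δ τ := by
    intro σ τ
    change (T (σ * τ)).val 1 1 = (T σ).val 1 1 * (T τ).val 1 1
    rw [hTmul, Units.val_mul, Matrix.mul_apply, Fin.sum_univ_two, hT10 σ, zero_mul, zero_add]
  have hδI : ∀ τ ∈ absInertia (𝔭bar.adicCompletion K), δ τ = 1 := fun τ hτ ↦ hTI τ hτ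
  -- the other place, inertia proportionality/ramification, the unramified combination `ν`, an arithmetic Frobenius
  obtain ⟨v, hpv, hne⟩ := FixFinal.exists_other_place h9 h8
  obtain ⟨τ₁, hτ₁I, hτ₁⟩ := exists_absInertia_apply_ne_one_of_isAnticyclotomic h7 hp2 κ h10 h9
  let κ₁ : absoluteGaloisGroup (𝔭bar.adicCompletion K) →ₜ* Multiplicative ℤ_[p] :=
    κ'.toContinuousMonoidHom.comp (localMap K (Sum.inl 𝔭bar))
  let κ₂ : absoluteGaloisGroup (𝔭bar.adicCompletion K) →ₜ* Multiplicative ℤ_[p] :=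
    κ.toContinuousMonoidHom.comp (localMap K (Sum.inl 𝔭bar))
  have hκ₁ : ∀ σ, κ₁ σ = κ' (localMap K (Sum.inl 𝔭bar) σ) := fun σ ↦ rfl
  have hκ₂ : ∀ σ, κ₂ σ = κ (localMap K (Sum.inl 𝔭bar) σ) := fun σ ↦ rfl
  have hprop : ∀ σ ∈ absInertia (𝔭bar.adicCompletion K), ∀ τ ∈ absInertia (𝔭bar.adicCompletion K),
      (κ₁ σ).toAdd * (κ₂ τ).toAdd = (κ₂ σ).toAdd * (κ₁ τ).toAdd :=
    fun σ hσ τ hτ ↦ absInertia_toAdd_mul_comm_of_split hK2 hp2 hpv h9 hne κ' κ hσ hτ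
  let ν : absoluteGaloisGroup (𝔭bar.adicCompletion K) →ₜ* Multiplicative ℤ_[p] :=
    { toFun := fun σ ↦ Multiplicative.ofAdd ((κ₂ τ₁).toAdd * (κ₁ σ).toAdd - (κ₁ τ₁).toAdd * (κ₂ σ).toAdd)
      map_one' := by rw [map_one κ₁, map_one κ₂, toAdd_one, mul_zero, mul_zero, sub_zero, ofAdd_zero]
      map_mul' := fun σ τ ↦ by
        rw [← ofAdd_add, map_mul κ₁, map_mul κ₂, toAdd_mul, toAdd_mul]; congr 1; ring
      continuous_toFun := continuous_ofAdd.comp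
        ((continuous_const.mul (continuous_toAdd.comp (map_continuous κ₁))).sub
          (continuous_const.mul (continuous_toAdd.comp (map_continuous κ₂)))) }
  have hν : ∀ σ, (ν σ).toAdd = (κ₂ τ₁).toAdd * (κ₁ σ).toAdd - (κ₁ τ₁).toAdd * (κ₂ σ).toAdd := fun σ ↦ rfl
  have hνI : ∀ τ ∈ absInertia (𝔭bar.adicCompletion K), ν τ = 1 := by
    intro τ hτ
    apply Multiplicative.toAdd.injective
    rw [hν, toAdd_one, hprop τ₁ hτ₁I τ hτ, mul_comm, sub_self]
  obtain ⟨σ₀, hσ₀⟩ := exists_isAbsArithFrob_holds (F := 𝔭bar.adicCompletion K)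
  have hν₀ : ν σ₀ ≠ 1 := by
    intro h0
    obtain ⟨n, hn⟩ := exists_pow_mul_mem_image_decomp h7 h9 κ κ' h10 h11
    obtain ⟨σ, hσ1, hσ2⟩ := hn 1 0
    have hνσ : ν σ = 1 := FixTwist.unramified_apply_eq_one_of_apply_frob_eq_one hσ₀ ν hνI h0 σ
    have h' := congrArg Multiplicative.toAdd hνσ
    rw [hν, toAdd_one, hκ₁ σ, hκ₂ σ, hσ1, hσ2, mul_zero, mul_zero, sub_zero, mul_one] at h'
    rcases mul_eq_zero.mp h' with h'' | h''
    · exact hτ₁ (Multiplicative.toAdd.injective (by rw [← hκ₂, h'', toAdd_one]))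
    · exact pow_ne_zero n (Nat.cast_ne_zero.mpr hp.ne_zero : (p : ℤ_[p]) ≠ 0) h''
  -- the Hecke root `α = δ(σ₀)` in `ℚ̄_p` and a compatible `ι' : ℚ̄_p ≃ ℂ`
  set α : PadicAlgCl p := ιO (δ σ₀) with hα
  have hroot : α ^ 2 - ιg ⟨(qExpansion 1 ⇑g).coeff p, coeff_mem_coeffField g p⟩ * α + (p : PadicAlgCl p) ^ (k - 1) = 0 :=
    hTF σ₀ hσ₀
  obtain ⟨ι', hι'⟩ := exists_padicAlgCl_ringEquiv_complex_apply_eq_of_finiteDimensional ιg (algebraMap (coeffField g) ℂ)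
  have hαnorm := norm_ringEquiv_ne_of_root_heckePolynomial_padic h1 h2 h4 ιg hroot hm₂ ι' (fun x ↦ hι' x)
  -- degree-one data at `𝔭̄`, `𝔭̄^h = (π)`, and the local symbol `σ_K`
  obtain ⟨he, hf⟩ := ramificationIdx_eq_one_and_inertiaDeg_eq_one_of_ncard_primesOver_eq_two (p := p) hK2 h8 𝔭bar h9
  obtain ⟨h, hh0, π, -, hπ⟩ := exists_pow_asIdeal_eq_span (K := K) 𝔭bar
  have hh : 0 < h := Nat.pos_of_ne_zero hh0
  obtain ⟨σK, hFrob, hker, φ, hφ⟩ :=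
    exists_isFrobPow_mem_kerSubgroup_cyclotomicCharacter_mul_sq_eq K p h7 𝔭bar h9 he hf h π hπ
  -- `κ(σ_K) = 0`
  have hK₂ : κ (localMap K (Sum.inl 𝔭bar) σK) = 1 := by
    have hmem := hker κ h10
    rwa [mem_kerSubgroup] at hmem
  -- `σ_K = σ₀^h · (inertia)`: values of unramified characters
  have hIK : σK * (σ₀ ^ h)⁻¹ ∈ absInertia (𝔭bar.adicCompletion K) := by
    have h0 : IsFrobPow (σ₀ ^ h) (h : ℤ) := by
      have := (IsAbsArithFrob.isFrobPow_holds hσ₀).pow h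
      rwa [mul_one] at this
    exact IsFrobPow.mul_inv_mem_absInertia_holds hFrob h0
  have hνK : (ν σK).toAdd = (h : ℤ_[p]) * (ν σ₀).toAdd := by
    have e : σK = σK * (σ₀ ^ h)⁻¹ * σ₀ ^ h := by rw [inv_mul_cancel_right]
    have h' : ν σK = ν (σK * (σ₀ ^ h)⁻¹) * ν (σ₀ ^ h) := by rw [← map_mul, ← e]
    rw [hνI _ hIK, one_mul, map_pow] at h'
    rw [h', toAdd_pow, nsmul_eq_mul]
  have hδK : δ σK = δ σ₀ ^ h := by
    have e : σK = σK * (σ₀ ^ h)⁻¹ * σ₀ ^ h := by rw [inv_mul_cancel_right]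
    have hpow : ∀ n : ℕ, δ (σ₀ ^ n) = δ σ₀ ^ n := by
      intro n; induction n with
      | zero => rw [pow_zero, pow_zero]; change (T 1).val 1 1 = 1; rw [hTone]; rfl
      | succ n ih => rw [pow_succ, hδmul, ih, pow_succ]
    calc δ σK = δ (σK * (σ₀ ^ h)⁻¹ * σ₀ ^ h) := by rw [← e]
      _ = δ (σK * (σ₀ ^ h)⁻¹) * δ (σ₀ ^ h) := hδmul _ _
      _ = δ σ₀ ^ h := by rw [hδI _ hIK, one_mul, hpow]
  -- `κ'(σ_K) ≠ 0`: else `σ_K ∈ ker ν`, but `ν(σ_K) = h ν(σ₀) ≠ 0`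
  have hK₁ : κ' (localMap K (Sum.inl 𝔭bar) σK) ≠ 1 := by
    intro h1K
    have hνK0 : (ν σK).toAdd = 0 := by
      rw [hν, hκ₁ σK, hκ₂ σK, h1K, hK₂, toAdd_one, mul_zero, mul_zero, sub_zero]
    rw [hνK] at hνK0
    rcases mul_eq_zero.mp hνK0 with h' | h'
    · exact hh.ne' (by exact_mod_cast h')
    · exact hν₀ (Multiplicative.toAdd.injective (by rw [h', toAdd_one]))
  -- `E = ε(σ_K)` in `ℚ̄_p`, `|ι' E| = p^h`
  set E : PadicAlgCl p := algebraMap ℚ_[p] (PadicAlgCl p)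
    (((GaloisRep.cyclotomicCharacter ℚ p (res σK) : ℤ_[p]ˣ) : ℤ_[p]) : ℚ_[p]) with hE
  have hεK : GaloisRep.cyclotomicCharacter K p (absGaloisRestrict K (𝔭bar.adicCompletion K) σK) =
      GaloisRep.cyclotomicCharacter ℚ p (res σK) :=
    cyclotomicCharacter_eq_cyclotomicCharacter_rat_absGaloisRestrict K p _
  have hEφ : E * (algebraMap ℚ_[p] (PadicAlgCl p) (φ (π : K))) ^ 2 = (p : PadicAlgCl p) ^ (2 * h) := by
    rw [hE, ← hεK, ← map_pow, ← map_mul, hφ, map_pow, map_natCast]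
  have hE0 : E ≠ 0 := by
    rw [hE, map_ne_zero_iff _ (algebraMap ℚ_[p] (PadicAlgCl p)).injective, ne_eq, PadicInt.coe_eq_zero]
    exact Units.ne_zero _
  have hEnorm : ‖ι' E‖ = (p : ℝ) ^ h := by
    let τ : K →+* ℂ := ι'.toRingHom.comp ((algebraMap ℚ_[p] (PadicAlgCl p)).comp φ)
    have hτ : ‖τ (π : K)‖ ^ 2 = (p : ℝ) ^ h := norm_embedding_sq_eq_of_pow_eq_span (p := p) h7 h9 hf hπ τ
    have hτπ : τ (π : K) = ι' (algebraMap ℚ_[p] (PadicAlgCl p) (φ (π : K))) := rfl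
    have h1 := congrArg (fun z ↦ ‖ι' z‖) hEφ
    simp only [map_mul, map_pow, map_natCast, norm_mul, norm_pow, Complex.norm_natCast] at h1
    rw [← hτπ, hτ, pow_mul, sq, mul_pow] at h1
    exact mul_right_cancel₀ (pow_ne_zero _ (Nat.cast_pos.mpr hp.pos).ne') h1
  -- `ψ(σ_K) = E^{1 − m₂}` and `det T(σ_K) = E^{2m₂ − 1}` in `ℚ̄_p`
  have hιOalg : ∀ x : ℤ_[p], ιO (algebraMap ℤ_[p] (padicCoeffIntegers ιg) x) = algebraMap ℚ_[p] (PadicAlgCl p) (x : ℚ_[p]) := by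
    intro x
    rw [hιO, padicCoeffIntegers.toPadicAlgCl_apply, padicCoeffIntegers.algebraMap_padicInt_eq,
      padicCoeffIntegers.coe_ofPadicInt, IsScalarTower.algebraMap_apply ℚ_[p] (padicCoeffField ιg) (PadicAlgCl p)]
    rfl
  have hcoeU : ∀ X : (padicCoeffIntegers ιg)ˣ,
      ιO (X : padicCoeffIntegers ιg) = ((Units.map (ιO : padicCoeffIntegers ιg →* PadicAlgCl p) X :
        (PadicAlgCl p)ˣ) : PadicAlgCl p) := fun X ↦ rfl
  have hzpowU : ∀ (X : (padicCoeffIntegers ιg)ˣ) (z : ℤ),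
      ιO ((X ^ z : (padicCoeffIntegers ιg)ˣ) : padicCoeffIntegers ιg) = (ιO (X : padicCoeffIntegers ιg)) ^ z := by
    intro X z
    rw [hcoeU, hcoeU, map_zpow, Units.val_zpow_eq_zpow_val]
  have hψE : ιO ((selfDualTwistChar ιg (res σK) : (padicCoeffIntegers ιg)ˣ) : padicCoeffIntegers ιg) = E ^ ((1 : ℤ) - m₂) := by
    rw [SelfDualTwist.selfDualTwistChar_apply, hk2, hzpowU, Units.coe_map, MonoidHom.coe_coe, hιOalg]
  have hdetE : ιO ((T σK).val 0 0) * ιO ((T σK).val 1 1) = E ^ m := by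
    have hdetT : (T σK).val.det = (T σK).val 0 0 * (T σK).val 1 1 := by
      rw [Matrix.det_fin_two, hT10 σK, mul_zero, sub_zero]
    have hdetF : (((T σK).val.det : padicCoeffIntegers ιg) : padicCoeffField ιg) =
        algebraMap ℚ_[p] (padicCoeffField ιg) ((GaloisRep.cyclotomicCharacter ℚ p (res σK) : ℤ_[p]ˣ) : ℤ_[p]) ^ m := by
      rw [hT]; exact FrameSelfDual.det_localFrame_eq Δ h1 h2 Q' (res σK) hm
    have hsc : ∀ y : ℚ_[p], ((algebraMap ℚ_[p] (padicCoeffField ιg) y : padicCoeffField ιg) : PadicAlgCl p) =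
        algebraMap ℚ_[p] (PadicAlgCl p) y :=
      fun y ↦ (IsScalarTower.algebraMap_apply ℚ_[p] (padicCoeffField ιg) (PadicAlgCl p) y).symm
    rw [← map_mul, ← hdetT, hιO, padicCoeffIntegers.toPadicAlgCl_apply, hdetF, hE, ← hsc]
    norm_cast
  -- the two values and their key identities
  set Θχ : PadicAlgCl p := ιO (((selfDualTwistChar ιg (res σK) : (padicCoeffIntegers ιg)ˣ) : padicCoeffIntegers ιg) *
    (T σK).val 0 0) with hΘχ
  set Θδ : PadicAlgCl p := ιO (((selfDualTwistChar ιg (res σK) : (padicCoeffIntegers ιg)ˣ) : padicCoeffIntegers ιg) *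
    (T σK).val 1 1) with hΘδ
  have hα0 : α ≠ 0 := by
    intro h0
    have hu : IsUnit (δ σ₀) := by
      have hdet : IsUnit (T σ₀).val.det := (T σ₀).isUnit.map Matrix.detMonoidHom
      rw [Matrix.det_fin_two, hT10 σ₀, mul_zero, sub_zero] at hdet
      exact isUnit_of_mul_isUnit_right hdet
    exact (hu.map ιO).ne_zero h0
  have hT11K : ιO ((T σK).val 1 1) = α ^ h := by
    change ιO (δ σK) = _; rw [hδK, map_pow]
  have hI1 : Θχ * α ^ h = E ^ m₂ := by
    rw [hΘχ, map_mul, hψE, mul_assoc, ← hT11K, hdetE, ← zpow_natCast E m, ← zpow_add₀ hE0, ← zpow_natCast E m₂]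
    congr 1
    omega
  have hI2 : Θδ * E ^ m₂ = E * α ^ h := by
    rw [hΘδ, map_mul, hψE, hT11K, mul_right_comm, ← zpow_natCast E m₂, ← zpow_add₀ hE0]
    have : ((1 : ℤ) - m₂ + (m₂ : ℕ)) = 1 := by omega
    rw [this, zpow_one]
  -- units of `𝒪`: `‖θ^N − 1‖ < 1` for the inverses
  have hunitψ : IsUnit (((selfDualTwistChar ιg (res σK) : (padicCoeffIntegers ιg)ˣ) : padicCoeffIntegers ιg)) := Units.isUnit _
  have hunit00 : IsUnit ((T σK).val 0 0) := by
    have hdet : IsUnit (T σK).val.det := (T σK).isUnit.map Matrix.detMonoidHom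
    rw [Matrix.det_fin_two, hT10 σK, mul_zero, sub_zero] at hdet
    exact isUnit_of_mul_isUnit_left hdet
  have hunit11 : IsUnit ((T σK).val 1 1) := by
    have hdet : IsUnit (T σK).val.det := (T σK).isUnit.map Matrix.detMonoidHom
    rw [Matrix.det_fin_two, hT10 σK, mul_zero, sub_zero] at hdet
    exact isUnit_of_mul_isUnit_right hdet
  have hsep_of : ∀ {x : padicCoeffIntegers ιg} (hx : IsUnit x), (∀ n : ℕ, 0 < n → (ιO x) ^ n ≠ 1) →
      ∀ a : ℕ → ℕ, Tendsto (fun n ↦ (ιO x)⁻¹ ^ a n) atTop (𝓝 1) → Tendsto (fun n ↦ ((a n : ℕ) : ℤ_[p])) atTop (𝓝 0) := by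
    intro x hx htors a ha
    obtain ⟨u, hu⟩ := hx
    have hinv : (ιO x)⁻¹ = ιO ((u⁻¹ : (padicCoeffIntegers ιg)ˣ) : padicCoeffIntegers ιg) := by
      rw [← hu]
      exact inv_eq_of_mul_eq_one_left (by rw [← map_mul, Units.inv_mul, map_one])
    obtain ⟨N, hN, hNlt⟩ := CharTorsionSelfDual.exists_norm_pow_sub_one_lt_one ιg (Units.isUnit u⁻¹)
    rw [← hinv] at hNlt
    refine Literature.NumberTheory.GaloisRepresentations.PadicUnitPowers.tendsto_natCast_padicInt_zero_of_tendsto_pow_of_norm_pow_sub_one_lt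
      hnat hN hNlt (fun n hn h1 ↦ htors n hn ?_) ha
    rw [inv_pow, inv_eq_one] at h1
    exact h1
  have hpR : (0 : ℝ) < p := Nat.cast_pos.mpr hp.pos
  -- `χ†`: a torsion value would give `|ι'α| = p^{m₂}`
  have keyχ : ∀ a : ℕ → ℕ, Tendsto (fun n ↦ Θχ⁻¹ ^ a n) atTop (𝓝 1) → Tendsto (fun n ↦ ((a n : ℕ) : ℤ_[p])) atTop (𝓝 0) := by
    refine hsep_of (hunitψ.mul hunit00) fun n hn hΘn ↦ ?_
    have hΘn' : Θχ ^ n = 1 := hΘn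
    have h1 : (α ^ h) ^ n = (E ^ m₂) ^ n := by rw [← hI1, mul_pow, hΘn', one_mul]
    have h2 := congrArg (fun z ↦ ‖ι' z‖) h1
    simp only [map_pow, norm_pow, hEnorm] at h2
    -- `(|α|^h)^n = ((p^h)^{m₂})^n`, so `|α|^h = (p^{m₂})^h` and `|α| = p^{m₂}`
    have h3 : ‖ι' α‖ ^ h = ((p : ℝ) ^ h) ^ m₂ :=
      eq_of_pow_eq_pow_of_nonneg (by positivity) (by positivity) hn h2
    rw [pow_right_comm] at h3
    exact hαnorm.1 (eq_of_pow_eq_pow_of_nonneg (by positivity) (by positivity) hh h3)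
  -- `δ†`: a torsion value would give `|ι'α|·p = p^{m₂}`
  have keyδ : ∀ a : ℕ → ℕ, Tendsto (fun n ↦ Θδ⁻¹ ^ a n) atTop (𝓝 1) → Tendsto (fun n ↦ ((a n : ℕ) : ℤ_[p])) atTop (𝓝 0) := by
    refine hsep_of (hunitψ.mul hunit11) fun n hn hΘn ↦ ?_
    have hΘn' : Θδ ^ n = 1 := hΘn
    have h1 : (E ^ m₂) ^ n = (E * α ^ h) ^ n := by rw [← hI2, mul_pow, hΘn', one_mul]
    have h2 := congrArg (fun z ↦ ‖ι' z‖) h1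
    simp only [map_pow, map_mul, norm_pow, norm_mul, hEnorm] at h2
    -- `((p^h)^{m₂})^n = (p^h · |α|^h)^n`, so `(p^{m₂})^h = (p |α|)^h` and `p |α| = p^{m₂}`
    have h3 : ((p : ℝ) ^ h) ^ m₂ = (p : ℝ) ^ h * ‖ι' α‖ ^ h :=
      eq_of_pow_eq_pow_of_nonneg (by positivity) (by positivity) hn h2
    have h4 : ((p : ℝ) ^ m₂) ^ h = ((p : ℝ) * ‖ι' α‖) ^ h := by
      rw [mul_pow, ← h3, pow_right_comm]
    have h5 := eq_of_pow_eq_pow_of_nonneg (by positivity) (by positivity) hh h4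
    exact hαnorm.2 (by rw [mul_comm]; exact h5.symm)
  refine ⟨σK, hK₂, hK₁, ?_, ?_⟩
  · simpa only [hΘχ, hT, hres, hιO] using keyχ
  · simpa only [hΘδ, hT, hres, hιO] using keyδ

end Summit.BirchSwinnertonDyer.BirchSwinnertonDyer.Theorems.ErratumThm23TwoVariable.CharSymbolSelfDual

end
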